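import Summits.Ventures.PercRepro.C041ZoneOCubeCountCS

/-!
# ROW C-041 — isomorphisms of abstract zones transport the one-anchor counts and the zone conjectures (p6, gen 29)

A ZONE ISOMORPHISM (`ZoneIso Z Z'`) is a quadruple of bijections — vertices, edges, `1`-edges, `2`-edges — commuting
with the end maps.  It induces a bijection of the states (`ZoneIso.state`, the colourings transported along the
edge bijections), under which red / blue adjacency (`adj_iff`), every reach (`mem_reach_iff`), the four mark sets
(`mem_Bl_iff`, …), the deleted vertices `D` / `D2` (`mem_D_iff`, `mem_D2_iff`), admissibility (`adm_iff`) and «blue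
at `K`» for a single anchor (`blueK_iff`) correspond.  Hence the four counts of the one-anchor count form agree
(`card_Fset`, `card_T1set`, `card_T2set`, `card_Iset`; `C041ZoneOCubeCountDefs`) and mine-3's CONJECTURES (ZONE
O-CUBE) and (ZONE CS) for one anchor transfer along the isomorphism (`zoneOCubeConj_iff`, `zoneCSConj_iff`) — the
tool that carries THEOREM (trees) (`C041TreeZoneBridge`, stated on the canonical zone of a tree) to any zone
isomorphic to it.
-/

namespace PercRepro

namespace ZoneZ

open ZoneData Finset

/-- An isomorphism of zones: bijections of vertices, edges, `1`-edges and `2`-edges commuting with the end maps. -/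
structure ZoneIso {V E T₁ T₂ V' E' T₁' T₂' : Type*} (Z : ZoneData V E T₁ T₂) (Z' : ZoneData V' E' T₁' T₂') where
  /-- the bijection of vertices -/
  v : V ≃ V'
  /-- the bijection of edges -/
  e : E ≃ E'
  /-- the bijection of `1`-edges -/
  t₁ : T₁ ≃ T₁'
  /-- the bijection of `2`-edges -/
  t₂ : T₂ ≃ T₂'
  /-- the first ends correspond -/
  fst_map : ∀ x, Z'.fst (e x) = v (Z.fst x)
  /-- the second ends correspond -/
  snd_map : ∀ x, Z'.snd (e x) = v (Z.snd x)
  /-- the vertices of the `1`-edges correspond -/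
  at₁_map : ∀ x, Z'.at₁ (t₁ x) = v (Z.at₁ x)
  /-- the vertices of the `2`-edges correspond -/
  at₂_map : ∀ x, Z'.at₂ (t₂ x) = v (Z.at₂ x)

namespace ZoneIso

variable {V E T₁ T₂ V' E' T₁' T₂' : Type*} {Z : ZoneData V E T₁ T₂} {Z' : ZoneData V' E' T₁' T₂'}
  (φ : ZoneIso Z Z')

/-- The induced bijection of states: every colouring transported along the corresponding bijection. -/
def state : State E T₁ T₂ ≃ State E' T₁' T₂' :=
  (Equiv.arrowCongr φ.e (Equiv.refl Bool)).prodCongr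
    ((Equiv.arrowCongr φ.t₁ (Equiv.refl Bool)).prodCongr (Equiv.arrowCongr φ.t₂ (Equiv.refl Bool)))

/-- The colour of a transported edge. -/
theorem state_fst (σ : State E T₁ T₂) (x : E) : (φ.state σ).1 (φ.e x) = σ.1 x := by
  simp [state]

/-- The colour of a transported `1`-edge. -/
theorem state_snd_fst (σ : State E T₁ T₂) (x : T₁) : (φ.state σ).2.1 (φ.t₁ x) = σ.2.1 x := by
  simp [state]

/-- The colour of a transported `2`-edge. -/
theorem state_snd_snd (σ : State E T₁ T₂) (x : T₂) : (φ.state σ).2.2 (φ.t₂ x) = σ.2.2 x := by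
  simp [state]

/-! ## Adjacency and reach -/

/-- Joining transports. -/
theorem joins_iff (x : E) (u w : V) : Z'.Joins (φ.e x) (φ.v u) (φ.v w) ↔ Z.Joins x u w := by
  unfold Joins
  rw [φ.fst_map, φ.snd_map, φ.v.apply_eq_iff_eq, φ.v.apply_eq_iff_eq, φ.v.apply_eq_iff_eq, φ.v.apply_eq_iff_eq]

/-- Adjacency through edges of a colour transports. -/
theorem adj_iff (c : Bool) (σ : State E T₁ T₂) (u w : V) :
    Z'.Adj (fun _ b => b = c) (φ.state σ) (φ.v u) (φ.v w) ↔ Z.Adj (fun _ b => b = c) σ u w := by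
  unfold Adj
  constructor
  · rintro ⟨x', hj, hc⟩
    refine ⟨φ.e.symm x', ?_, ?_⟩
    · rw [← φ.joins_iff, φ.e.apply_symm_apply]
      exact hj
    · rw [← φ.state_fst, φ.e.apply_symm_apply]
      exact hc
  · rintro ⟨x, hj, hc⟩
    exact ⟨φ.e x, (φ.joins_iff x u w).2 hj, by rw [φ.state_fst]; exact hc⟩

/-- Paths transport (forward). -/
theorem reflTransGen_map (c : Bool) (σ : State E T₁ T₂) {u w : V}
    (h : Relation.ReflTransGen (Z.Adj (fun _ b => b = c) σ) u w) :
    Relation.ReflTransGen (Z'.Adj (fun _ b => b = c) (φ.state σ)) (φ.v u) (φ.v w) := by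
  induction h with
  | refl => exact Relation.ReflTransGen.refl
  | tail _ h ih => exact ih.tail ((φ.adj_iff c σ _ _).2 h)

/-- Paths transport (backward). -/
theorem reflTransGen_of_map (c : Bool) (σ : State E T₁ T₂) {u' w' : V'}
    (h : Relation.ReflTransGen (Z'.Adj (fun _ b => b = c) (φ.state σ)) u' w') :
    Relation.ReflTransGen (Z.Adj (fun _ b => b = c) σ) (φ.v.symm u') (φ.v.symm w') := by
  induction h with
  | refl => exact Relation.ReflTransGen.refl
  | tail _ h ih =>
    refine ih.tail ((φ.adj_iff c σ _ _).1 ?_)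
    rw [φ.v.apply_symm_apply, φ.v.apply_symm_apply]
    exact h

/-- Reaches transport: a transported vertex is reached from the image of `S` iff the vertex is reached from `S`. -/
theorem mem_reach_iff (c : Bool) (σ : State E T₁ T₂) (S : Set V) (u : V) :
    φ.v u ∈ reach (Z'.Adj (fun _ b => b = c) (φ.state σ)) (φ.v '' S) ↔
      u ∈ reach (Z.Adj (fun _ b => b = c) σ) S := by
  constructor
  · rintro ⟨s', ⟨s, hs, rfl⟩, hsu⟩
    refine ⟨s, hs, ?_⟩
    have h := φ.reflTransGen_of_map c σ hsu
    rwa [φ.v.symm_apply_apply, φ.v.symm_apply_apply] at h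
  · rintro ⟨s, hs, hsu⟩
    exact ⟨φ.v s, ⟨s, hs, rfl⟩, φ.reflTransGen_map c σ hsu⟩

/-! ## Marks -/

/-- A mark set transports. -/
theorem mem_markSet_iff {T T' : Type*} (at_ : T → V) (at' : T' → V') (f : T ≃ T')
    (hf : ∀ x, at' (f x) = φ.v (at_ x)) (m : T → Bool) (m' : T' → Bool) (hm : ∀ x, m' (f x) = m x) (b : Bool)
    (u : V) : φ.v u ∈ markSet at' m' b ↔ u ∈ markSet at_ m b := by
  unfold markSet
  constructor
  · rintro ⟨t', ht, hmt⟩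
    refine ⟨f.symm t', ?_, ?_⟩
    · rw [← φ.v.apply_eq_iff_eq, ← hf, f.apply_symm_apply]
      exact ht
    · rw [← hm, f.apply_symm_apply]
      exact hmt
  · rintro ⟨t, ht, hmt⟩
    exact ⟨f t, by rw [hf, ht], by rw [hm]; exact hmt⟩

/-- The blockers transport. -/
theorem mem_Bl_iff (σ : State E T₁ T₂) (u : V) : φ.v u ∈ Z'.Bl (φ.state σ) ↔ u ∈ Z.Bl σ :=
  φ.mem_markSet_iff Z.at₁ Z'.at₁ φ.t₁ φ.at₁_map σ.2.1 _ (φ.state_snd_fst σ) false u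

/-- The red `1`-marks transport. -/
theorem mem_Blt_iff (σ : State E T₁ T₂) (u : V) : φ.v u ∈ Z'.Blt (φ.state σ) ↔ u ∈ Z.Blt σ :=
  φ.mem_markSet_iff Z.at₁ Z'.at₁ φ.t₁ φ.at₁_map σ.2.1 _ (φ.state_snd_fst σ) true u

/-- The `2`-blockers transport. -/
theorem mem_M_iff (σ : State E T₁ T₂) (u : V) : φ.v u ∈ Z'.M (φ.state σ) ↔ u ∈ Z.M σ :=
  φ.mem_markSet_iff Z.at₂ Z'.at₂ φ.t₂ φ.at₂_map σ.2.2 _ (φ.state_snd_snd σ) false u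

/-- The red `2`-marks transport. -/
theorem mem_Mt_iff (σ : State E T₁ T₂) (u : V) : φ.v u ∈ Z'.Mt (φ.state σ) ↔ u ∈ Z.Mt σ :=
  φ.mem_markSet_iff Z.at₂ Z'.at₂ φ.t₂ φ.at₂_map σ.2.2 _ (φ.state_snd_snd σ) true u

/-- A set of transported vertices characterised pointwise is an image. -/
theorem image_eq_of_forall {S : Set V} {S' : Set V'} (h : ∀ u, φ.v u ∈ S' ↔ u ∈ S) : S' = φ.v '' S := by
  ext u'
  rw [← φ.v.apply_symm_apply u', h, φ.v.injective.mem_set_image]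

/-- The blockers of the image. -/
theorem Bl_state (σ : State E T₁ T₂) : Z'.Bl (φ.state σ) = φ.v '' Z.Bl σ :=
  φ.image_eq_of_forall (φ.mem_Bl_iff σ)

/-- The `2`-blockers of the image. -/
theorem M_state (σ : State E T₁ T₂) : Z'.M (φ.state σ) = φ.v '' Z.M σ :=
  φ.image_eq_of_forall (φ.mem_M_iff σ)

/-! ## The zone sets -/

/-- The deleted vertices transport. -/
theorem mem_D_iff (σ : State E T₁ T₂) (u : V) : φ.v u ∈ Z'.D (φ.state σ) ↔ u ∈ Z.D σ := by
  unfold D BlueAdj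
  rw [φ.Bl_state]
  exact φ.mem_reach_iff false σ _ u

/-- The vertices deleted on side `2` transport. -/
theorem mem_D2_iff (σ : State E T₁ T₂) (u : V) : φ.v u ∈ Z'.D2 (φ.state σ) ↔ u ∈ Z.D2 σ := by
  unfold D2 BlueAdj
  rw [φ.M_state]
  exact φ.mem_reach_iff false σ _ u

/-- Admissibility transports. -/
theorem adm_iff (σ : State E T₁ T₂) : Z'.adm (φ.state σ) ↔ Z.adm σ := by
  unfold adm
  rw [Set.disjoint_left, Set.disjoint_left]
  constructor
  · intro h m hm hmD
    exact h ((φ.mem_M_iff σ m).2 hm) ((φ.mem_D_iff σ m).2 hmD)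
  · intro h m' hm hmD
    rw [← φ.v.apply_symm_apply m', φ.mem_M_iff] at hm
    rw [← φ.v.apply_symm_apply m', φ.mem_D_iff] at hmD
    exact h hm hmD

/-- The red reach of a single anchor transports. -/
theorem mem_K_iff (σ : State E T₁ T₂) (k u : V) : φ.v u ∈ Z'.K {φ.v k} (φ.state σ) ↔ u ∈ Z.K {k} σ := by
  unfold K RedAdj
  rw [← Set.image_singleton]
  exact φ.mem_reach_iff true σ _ u

/-- «Blue at `K`» for a single anchor transports. -/
theorem blueK_iff (σ : State E T₁ T₂) (k : V) : Z'.blueK {φ.v k} (φ.state σ) ↔ Z.blueK {k} σ := by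
  unfold blueK
  rw [Set.disjoint_left, Set.disjoint_left]
  constructor
  · intro h u hu hum
    refine h ((φ.mem_K_iff σ k u).2 hu) ?_
    rcases hum with h1 | h2
    · exact Or.inl ((φ.mem_Blt_iff σ u).2 h1)
    · exact Or.inr ((φ.mem_Mt_iff σ u).2 h2)
  · intro h u' hu hum
    rw [← φ.v.apply_symm_apply u', φ.mem_K_iff] at hu
    refine h hu ?_
    rw [← φ.v.apply_symm_apply u'] at hum
    rcases hum with h1 | h2
    · exact Or.inl ((φ.mem_Blt_iff σ _).1 h1)
    · exact Or.inr ((φ.mem_Mt_iff σ _).1 h2)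

/-! ## The one-anchor counts and conjectures -/

section Counts

variable [Fintype E] [DecidableEq E] [Fintype T₁] [DecidableEq T₁] [Fintype T₂] [DecidableEq T₂]
  [Fintype E'] [DecidableEq E'] [Fintype T₁'] [DecidableEq T₁'] [Fintype T₂'] [DecidableEq T₂'] (k : V)

/-- `#F` transports. -/
theorem card_Fset : #(Z'.Fset (φ.v k)) = #(Z.Fset k) := by
  symm
  refine Finset.card_equiv φ.state fun σ => ?_
  rw [mem_Fset, mem_Fset, φ.adm_iff, φ.mem_D_iff, φ.mem_D2_iff]

/-- `#T₁` transports. -/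
theorem card_T1set : #(Z'.T1set (φ.v k)) = #(Z.T1set k) := by
  symm
  refine Finset.card_equiv φ.state fun σ => ?_
  rw [mem_T1set, mem_T1set, φ.adm_iff, φ.mem_D_iff]

/-- `#T₂` transports. -/
theorem card_T2set : #(Z'.T2set (φ.v k)) = #(Z.T2set k) := by
  symm
  refine Finset.card_equiv φ.state fun σ => ?_
  rw [mem_T2set, mem_T2set, φ.adm_iff, φ.mem_D2_iff]

/-- `#I` transports. -/
theorem card_Iset : #(Z'.Iset (φ.v k)) = #(Z.Iset k) := by
  symm
  refine Finset.card_equiv φ.state fun σ => ?_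
  rw [mem_Iset, mem_Iset, φ.adm_iff, φ.blueK_iff]

/-- **The one-anchor ZONE O-CUBE transports along a zone isomorphism.** -/
theorem zoneOCubeConj_iff : Z'.ZoneOCubeConj {φ.v k} (∅ : Set V') ↔ Z.ZoneOCubeConj {k} (∅ : Set V) := by
  rw [zoneOCubeConj_single_iff, zoneOCubeConj_single_iff, φ.card_Fset, φ.card_T1set, φ.card_T2set, φ.card_Iset]

/-- **The one-anchor ZONE (CS) transports along a zone isomorphism.** -/
theorem zoneCSConj_iff : Z'.ZoneCSConj {φ.v k} (∅ : Set V') ↔ Z.ZoneCSConj {k} (∅ : Set V) := by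
  rw [zoneCSConj_single_iff, zoneCSConj_single_iff, φ.card_Fset, φ.card_T1set, φ.card_T2set, φ.card_Iset]

end Counts

end ZoneIso

end ZoneZ

end PercRepro
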